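import Summits.HodgeConjecture.HodgeConjecture.Theorems.LimitExtensionHypersurfaceHodgeFourLowDegreeStrongLines
import Summits.HodgeConjecture.HodgeConjecture.Theorems.LimitExtensionHypersurfaceHodgeFourLowDegreeQuadric
import Summits.HodgeConjecture.HodgeConjecture.Theses.FiniteTreeOfFlavours

/-!
# Birth skeleton for crux `HypersurfaceHodgeFour` (stmt-HodgeConjecture-2997), route `LimitExtension`

    HypersurfaceHodgeFour := ∀ ⦃d : ℕ⦄ ⦃X : SchemeOver ℂ⦄,
      IsSmoothHypersurface 4 d X → HodgeConjectureFor 4 X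

— the Hodge conjecture for EVERY smooth hypersurface fourfold `X_d ⊂ ℙ⁵_ℂ` (Hodge model + every
rational `(p,p)`-class algebraic, every `p`, every degree `d`). Rank-5 crux of route `LimitExtension`
(partner of `LimitExtensionFour` in the fourfold milestone `HodgeFourfolds`); the `n = 4` instance of
the target `HypersurfaceHodge` it shares with route `FiniteTreeOfFlavours`.

## The line (REGIME DECOMPOSITION of the `(2,2)`-slice: Fano range `d ≤ 5` / BKU range `d ≥ 6`,
## the latter cut along the movable / rigid dichotomy of Hodge classes)

Step 0 (PROVED in the tree, used by name in the assembly — no stub): for ONE smooth hypersurface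
fourfold of any degree, `HodgeConjectureFor 4 X` reduces to its `(2,2)`-slice "every rational
`(2,2)`-class of `H⁴(X(ℂ); ℂ)` is algebraic"
(`Theorems.limitExtension_hypersurfaceHodgeFour_of_twoTwo`: the Hodge model is
`nonempty_hodgeModel_holds`; every degree `2p ≠ 4` is the discharged Lefschetz theorem for smooth
hypersurfaces `Voisin2003_smoothHypersurface_algebraicClasses_eq_top_holds`, `H²ᵖ = ℂ·hᵖ`).

The `(2,2)`-slice is then cut into FOUR named stubs along the two regimes in which different
mechanisms own the problem:

* STUB 1 `stub_fanoRange` — **Fano range `d ≤ 5`** (KNOWN in print; `X_d` Fano ⟺ `d ≤ 5`, then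
  `CH₀(X) = ℤ` is supported on a hyperplane section and Bloch–Srinivas' decomposition of the diagonal
  gives HC in codimension 2): the `(2,2)`-slice for `d ≤ 5`. Literally the `(2,2)`-slice of the
  route's support item `HypersurfaceHodgeFourLowDegree` (stmt-HodgeConjecture-3003; landed iff
  `Theorems.limitExtension_hypersurfaceHodgeFourLowDegree_iff_twoTwo`), and CLOSED MODULO the single
  named fact `BlochSrinivas1983_hodgeConjectureDegreeFour_of_chowZeroSupported` by the landed
  `Theorems.limitExtension_hypersurfaceHodgeFourLowDegree_of_blochSrinivas_only` (Roitman strong lines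
  for the quintic; `d ≤ 2` proved outright) — see the sanity `example`s below. Size M (discharge of
  Prop. 10.26 on the tree's carriers = the Gysin / cycle-class construction).
* STUB 2 `stub_movable` — **BKU range `d ≥ 6`, MOVABLE classes**: a rational `(2,2)`-class on a
  smooth hypersurface fourfold of degree `d ≥ 6` that MOVES (is the restriction of a rational
  `(2,2)`-class `Λ` on a smooth projective fivefold `𝒴 → C` over a smooth projective curve having
  `X` as a fibre, only finitely many fibres `≅ X`) is algebraic. For `d ≥ 6` the universal family
  `U_{4,d}` has level `≥ 3` (`h^{4,0} ≠ 0`), so by Baldi–Klingler–Ullmo (Thm 2.3/2.6, Cor 2.7) the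
  movable pairs lie over FINITELY many maximal atypical special subvarieties per degree — a finite
  classification problem (IVHS / Jacobian ring: Otwinowska, Villaflor Loyola; variational HC on flag
  loci `{X ⊇ S}`: Dan, Kloosterman). The `(n,k) = (4,2)`, `d ≥ 6` instance of FiniteTreeOfFlavours'
  crux `MovableClassesAlgebraic` (stmt-1493); contains its `(4,6)` testbed
  `MovableClassesAlgebraicSextic` (stmt-1492). OPEN (L/XL per degree; open-ended in `d`).
* STUB 3 `stub_rigidQbar` — **BKU range, RIGID classes live over `ℚ̄`**: a rational `(2,2)`-class
  that does NOT move forces `X ≅ V₊(F)` with `F` a sextic-or-higher form with algebraic coefficients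
  (isolated points of Hodge loci mod `PGL(6)` are `ℚ̄`-points: the residual point case of
  Klingler–Otwinowska–Urbanik Cor 1.14; Saito–Schnell; bi-algebraic / Ax–Schanuel transcendence). The
  `(4,2)`, `d ≥ 6` instance of FiniteTreeOfFlavours' `RigidImpliesQbar` (stmt-1494). OPEN; the ONE
  stub not formally implied by the crux (HC ⟹ it only through spreading out a cycle) — the line's
  key risk and its cheapest kill (a certified rigid Hodge class at a transcendental modulus refutes
  the stub AND the summit).
* STUB 4 `stub_rigidQbarAlgebraic` — **BKU range, RIGID classes on `ℚ̄`-hypersurface fourfolds are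
  algebraic** (the arithmetic heart: contains HC for every CM sextic-or-higher fourfold, e.g. Fermat
  `X⁴_d`, `d ≥ 6` — known for `d` prime or `d ≤ 20` (Shioda, Ran, Aoki), open from `d = 21`;
  engines: absolute Hodge / CM realisation, inductive structure of Fermat motives, p-adic
  semiregular lifting of the host summit's other routes). The `(4,2)`, `d ≥ 6` instance of
  FiniteTreeOfFlavours' `RigidQbarClassesAlgebraic` (stmt-1495). OPEN. HARDEST (with STUB 2).

`HypersurfaceHodgeFour_of` composes the four registered stubs (hypotheses keyed by stub name through
the `Registered` aliases) into the crux BY NAME: Step 0, then `d ≤ 5` ↦ STUB 1, else (`6 ≤ d`) the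
tautological case split "`c` moves or not" ↦ STUB 2, resp. STUB 4 fed by STUB 3 — kernel-checked,
the only `sorry`s of the file sit inside `stub_*`.

## Why this cut (and not `d ≤ 5` / `d ≥ 6` alone)

A bare degree split would hide the whole difficulty in one unnamed `d ≥ 6` stub. The movable /
rigid cut is the one the route header itself prescribes for this crux ("the sextic is
FiniteTreeOfFlavours' MovableClassesAlgebraicSextic testbed (movable classes) plus rigid classes")
and it separates three problems of different NATURE — a finite geometric classification per degree
(STUB 2, o-minimality + IVHS), a transcendence statement about period maps (STUB 3), an arithmetic
statement about `ℚ̄`-hypersurfaces (STUB 4) — while STUB 1 isolates the regime where a fourth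
mechanism (rational curves / `CH₀`) already won. Stubs 1, 2, 4 are NECESSARY (formally implied by
the crux: `example`s below), so only STUB 3 can die without killing the crux.

## Disproof used

None exists: `ledger crux ls stmt-HodgeConjecture-2997` lists no workfiles (no `Disproof.lean`, no
`_false_without_` theorem, no `-- Targets`, no landed `Theorems/HypersurfaceHodgeFour/Negative/`
lemma) and the payload carries no `disproof_path`; `ledger negatives --problem HodgeConjecture`
(2026-08-17: 2 entries — a Fermat `m = 110` multiset statement of DerivedTorelliFermat and a
22 × 22 matrix statement of ELineTransport) contains nothing about hypersurface fourfolds, movable /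
rigid classes or fields of definition. Dead lines: none recorded for this crux.

## Leans on (by name)

`Theorems.limitExtension_hypersurfaceHodgeFour_of_twoTwo` (Step 0, proved);
`Theorems.limitExtension_twoTwo_of_hypersurfaceHodgeFourLowDegree`,
`Theorems.limitExtension_hypersurfaceHodgeFourLowDegree_of_blochSrinivas_only` (STUB 1 modulo
`Literature.Barriers.HodgeConjecture.BlochSrinivas1983_hodgeConjectureDegreeFour_of_chowZeroSupported`);
`Theorems.limitExtension_hypersurfaceHodgeFourLowDegree_of_le_two` (BC5 special case `d ≤ 2` of the
crux, proved outright: last `example`); FiniteTreeOfFlavours' cruxes `MovableClassesAlgebraic`, `RigidImpliesQbar`,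
`RigidQbarClassesAlgebraic` (each open stub is an instance — `example`s below); carriers
`Motives.{SchemeOver, IsSmoothHypersurface, IsSmoothProjective, AlgPoints, fiberOver, fiberι,
IsHypersurfaceCutOutBy}`, `HodgeTheory.{complexBetti, complexBetti.map, IsRationalClass,
IsOfHodgeType, algebraicClasses, HodgeConjectureFor}` (all existing declarations; nothing new is
defined except the four stub statements and their name-keyed aliases).

Sources: BaldiKlinglerUllmo2024 (arXiv:2107.08838, Thm 2.3/2.6, Cor 2.7), KlinglerOtwinowskaUrbanik2023
(arXiv:2010.03359, Cor 1.13/1.14), Otwinowska2002, Villaflorloyola2021, arXiv:1404.7519,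
arXiv:2104.14845, arXiv:1408.2488, Shioda1979HodgeFermat, VoisinHodgeII2003 (Prop. 10.26),
Zucker1977CubicFourfolds, ConteMurre1978, BlochSrinivas1983.
-/

set_option linter.dupNamespace false

noncomputable section

open CategoryTheory AlgebraicGeometry

namespace Summit.HodgeConjecture.HodgeConjecture.Cruxes.HypersurfaceHodgeFour.Birth

open Literature.AlgebraicGeometry Literature.AlgebraicGeometry.Motives
open Literature.AlgebraicGeometry.HodgeTheory
open Summit.HodgeConjecture.HodgeConjecture.Theses.LimitExtension

/-! ## The four stub statements -/

/-- STUB 1 statement — **Fano range**: for `d ≤ 5`, every rational `(2,2)`-class on a smooth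
hypersurface fourfold of degree `d` is algebraic. KNOWN (`ℙ⁴`, quadric: cellular; cubic: Zucker 1977 /
Murre 1977; quartic, quintic: Conte–Murre 1978; uniformly: Fano ⟹ `CH₀` supported on a hyperplane
section ⟹ Bloch–Srinivas Prop. 10.26). Verbatim the `(2,2)`-slice of the route's support item
`HypersurfaceHodgeFourLowDegree` (stmt-HodgeConjecture-3003), closed in the tree modulo the named
fact `BlochSrinivas1983_hodgeConjectureDegreeFour_of_chowZeroSupported`. Why it might fail: it cannot
(theorem in print); as a work item it waits for the Gysin / cycle-class construction discharging
Prop. 10.26. Size M. -/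
def FanoRangeTwoTwo : Prop :=
  ∀ ⦃d : ℕ⦄ ⦃X : SchemeOver ℂ⦄, d ≤ 5 → IsSmoothHypersurface 4 d X →
    ∀ c : complexBetti X (2 * 2), IsRationalClass c → IsOfHodgeType 4 X (2 * 2) 2 2 c →
      c ∈ algebraicClasses X 2

/-- STUB 2 statement — **BKU range, movable classes**: for `d ≥ 6`, a rational `(2,2)`-class `c` on
a smooth hypersurface fourfold `X` of degree `d` which MOVES — `c` is the restriction of a rational
`(2,2)`-class `Λ` on a smooth projective fivefold `𝒴 → C` over a smooth projective curve with `X` a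
fibre and only finitely many fibres isomorphic to `X` — is algebraic. The `(n,k) = (4,2)`, `d ≥ 6`
instance of `FiniteTreeOfFlavours.MovableClassesAlgebraic`. Why it might fail: false iff HC fails
along a positive-dimensional family of hypersurface fourfolds (a maximal atypical component of a
Hodge locus of `U_{4,d}` explained by no relative cycle); as a work item, below the first BKU layer
the tree of special subvarieties may be infinite. Size XL / open. -/
def MovableTwoTwo : Prop :=
  ∀ ⦃d : ℕ⦄ ⦃X : SchemeOver ℂ⦄, 6 ≤ d → IsSmoothHypersurface 4 d X →
    ∀ c : complexBetti X (2 * 2), IsRationalClass c → IsOfHodgeType 4 X (2 * 2) 2 2 c →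
      (∃ (𝒴 C : SchemeOver ℂ) (π : 𝒴 ⟶ C) (t : AlgPoints C ℂ) (e : X ≅ fiberOver π t)
          (Λ : complexBetti 𝒴 (2 * 2)),
        IsSmoothProjective (4 + 1) 𝒴 ∧ IsSmoothProjective 1 C ∧ IsRationalClass Λ ∧
          IsOfHodgeType (4 + 1) 𝒴 (2 * 2) 2 2 Λ ∧
          (complexBetti.map (e.hom ≫ fiberι π t) (2 * 2)).hom Λ = c ∧
          Set.Finite {t' : AlgPoints C ℂ | Nonempty (fiberOver π t' ≅ X)}) →
      c ∈ algebraicClasses X 2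

/-- STUB 3 statement — **BKU range, rigid classes live over `ℚ̄`**: for `d ≥ 6`, if a smooth
hypersurface fourfold `X` of degree `d` carries a rational `(2,2)`-class that does NOT move, then
`X` is the hypersurface of a degree-`d` form with algebraic coefficients. The `(4,2)`, `d ≥ 6`
instance of `FiniteTreeOfFlavours.RigidImpliesQbar` (KOU Cor 1.14's residual point case). Why it
might fail: a certified rigid Hodge class at a transcendental modulus (which would also refute HC);
NOT formally implied by the crux. Size XL / open. -/
def RigidImpliesQbarFour : Prop :=
  ∀ ⦃d : ℕ⦄ ⦃X : SchemeOver ℂ⦄, 6 ≤ d → IsSmoothHypersurface 4 d X →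
    ∀ c : complexBetti X (2 * 2), IsRationalClass c → IsOfHodgeType 4 X (2 * 2) 2 2 c →
      ¬ (∃ (𝒴 C : SchemeOver ℂ) (π : 𝒴 ⟶ C) (t : AlgPoints C ℂ) (e : X ≅ fiberOver π t)
          (Λ : complexBetti 𝒴 (2 * 2)),
        IsSmoothProjective (4 + 1) 𝒴 ∧ IsSmoothProjective 1 C ∧ IsRationalClass Λ ∧
          IsOfHodgeType (4 + 1) 𝒴 (2 * 2) 2 2 Λ ∧
          (complexBetti.map (e.hom ≫ fiberι π t) (2 * 2)).hom Λ = c ∧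
          Set.Finite {t' : AlgPoints C ℂ | Nonempty (fiberOver π t' ≅ X)}) →
      ∃ F : MvPolynomial (Fin (4 + 2)) ℂ, F.IsHomogeneous d ∧ (∀ m, IsAlgebraic ℚ (F.coeff m)) ∧
        IsHypersurfaceCutOutBy (4 + 1) F X

/-- STUB 4 statement — **BKU range, rigid classes on `ℚ̄`-hypersurface fourfolds are algebraic**:
for `d ≥ 6`, on a smooth hypersurface fourfold cut out by a degree-`d` form with algebraic
coefficients, every rational `(2,2)`-class that does not move is algebraic. The `(4,2)`, `d ≥ 6`
instance of `FiniteTreeOfFlavours.RigidQbarClassesAlgebraic`; contains HC for the Fermat fourfolds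
`X⁴_d`, `d ≥ 6` (known `d` prime or `≤ 20`, open from `21`). Why it might fail: only with HC; as a
work item, non-CM rigid classes (if any) carry no structure to exploit. Size XL / open. HARDEST. -/
def RigidQbarTwoTwo : Prop :=
  ∀ ⦃d : ℕ⦄ ⦃X : SchemeOver ℂ⦄, 6 ≤ d → IsSmoothHypersurface 4 d X →
    (∃ F : MvPolynomial (Fin (4 + 2)) ℂ, F.IsHomogeneous d ∧ (∀ m, IsAlgebraic ℚ (F.coeff m)) ∧
        IsHypersurfaceCutOutBy (4 + 1) F X) →
    ∀ c : complexBetti X (2 * 2), IsRationalClass c → IsOfHodgeType 4 X (2 * 2) 2 2 c →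
      ¬ (∃ (𝒴 C : SchemeOver ℂ) (π : 𝒴 ⟶ C) (t : AlgPoints C ℂ) (e : X ≅ fiberOver π t)
          (Λ : complexBetti 𝒴 (2 * 2)),
        IsSmoothProjective (4 + 1) 𝒴 ∧ IsSmoothProjective 1 C ∧ IsRationalClass Λ ∧
          IsOfHodgeType (4 + 1) 𝒴 (2 * 2) 2 2 Λ ∧
          (complexBetti.map (e.hom ≫ fiberι π t) (2 * 2)).hom Λ = c ∧
          Set.Finite {t' : AlgPoints C ℂ | Nonempty (fiberOver π t' ≅ X)}) →
      c ∈ algebraicClasses X 2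

/-! ## The registered stubs (statements inlined verbatim from the `def`s above) -/

/-- STUB 1 — Fano range `d ≤ 5` (`FanoRangeTwoTwo`). Known; M. -/
theorem stub_fanoRange :
    ∀ ⦃d : ℕ⦄ ⦃X : SchemeOver ℂ⦄, d ≤ 5 → IsSmoothHypersurface 4 d X →
      ∀ c : complexBetti X (2 * 2), IsRationalClass c → IsOfHodgeType 4 X (2 * 2) 2 2 c →
        c ∈ algebraicClasses X 2 := by
  sorry

/-- STUB 2 — movable `(2,2)`-classes, `d ≥ 6` (`MovableTwoTwo`). Open; XL. -/
theorem stub_movable :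
    ∀ ⦃d : ℕ⦄ ⦃X : SchemeOver ℂ⦄, 6 ≤ d → IsSmoothHypersurface 4 d X →
      ∀ c : complexBetti X (2 * 2), IsRationalClass c → IsOfHodgeType 4 X (2 * 2) 2 2 c →
        (∃ (𝒴 C : SchemeOver ℂ) (π : 𝒴 ⟶ C) (t : AlgPoints C ℂ) (e : X ≅ fiberOver π t)
            (Λ : complexBetti 𝒴 (2 * 2)),
          IsSmoothProjective (4 + 1) 𝒴 ∧ IsSmoothProjective 1 C ∧ IsRationalClass Λ ∧
            IsOfHodgeType (4 + 1) 𝒴 (2 * 2) 2 2 Λ ∧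
            (complexBetti.map (e.hom ≫ fiberι π t) (2 * 2)).hom Λ = c ∧
            Set.Finite {t' : AlgPoints C ℂ | Nonempty (fiberOver π t' ≅ X)}) →
        c ∈ algebraicClasses X 2 := by
  sorry

/-- STUB 3 — rigid classes force a `ℚ̄`-form, `d ≥ 6` (`RigidImpliesQbarFour`). Open; XL. -/
theorem stub_rigidQbar :
    ∀ ⦃d : ℕ⦄ ⦃X : SchemeOver ℂ⦄, 6 ≤ d → IsSmoothHypersurface 4 d X →
      ∀ c : complexBetti X (2 * 2), IsRationalClass c → IsOfHodgeType 4 X (2 * 2) 2 2 c →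
        ¬ (∃ (𝒴 C : SchemeOver ℂ) (π : 𝒴 ⟶ C) (t : AlgPoints C ℂ) (e : X ≅ fiberOver π t)
            (Λ : complexBetti 𝒴 (2 * 2)),
          IsSmoothProjective (4 + 1) 𝒴 ∧ IsSmoothProjective 1 C ∧ IsRationalClass Λ ∧
            IsOfHodgeType (4 + 1) 𝒴 (2 * 2) 2 2 Λ ∧
            (complexBetti.map (e.hom ≫ fiberι π t) (2 * 2)).hom Λ = c ∧
            Set.Finite {t' : AlgPoints C ℂ | Nonempty (fiberOver π t' ≅ X)}) →
        ∃ F : MvPolynomial (Fin (4 + 2)) ℂ, F.IsHomogeneous d ∧ (∀ m, IsAlgebraic ℚ (F.coeff m)) ∧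
          IsHypersurfaceCutOutBy (4 + 1) F X := by
  sorry

/-- STUB 4 — rigid classes on `ℚ̄`-hypersurface fourfolds are algebraic, `d ≥ 6`
(`RigidQbarTwoTwo`). Open; XL; HARDEST. -/
theorem stub_rigidQbarAlgebraic :
    ∀ ⦃d : ℕ⦄ ⦃X : SchemeOver ℂ⦄, 6 ≤ d → IsSmoothHypersurface 4 d X →
      (∃ F : MvPolynomial (Fin (4 + 2)) ℂ, F.IsHomogeneous d ∧ (∀ m, IsAlgebraic ℚ (F.coeff m)) ∧
          IsHypersurfaceCutOutBy (4 + 1) F X) →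
      ∀ c : complexBetti X (2 * 2), IsRationalClass c → IsOfHodgeType 4 X (2 * 2) 2 2 c →
        ¬ (∃ (𝒴 C : SchemeOver ℂ) (π : 𝒴 ⟶ C) (t : AlgPoints C ℂ) (e : X ≅ fiberOver π t)
            (Λ : complexBetti 𝒴 (2 * 2)),
          IsSmoothProjective (4 + 1) 𝒴 ∧ IsSmoothProjective 1 C ∧ IsRationalClass Λ ∧
            IsOfHodgeType (4 + 1) 𝒴 (2 * 2) 2 2 Λ ∧
            (complexBetti.map (e.hom ≫ fiberι π t) (2 * 2)).hom Λ = c ∧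
            Set.Finite {t' : AlgPoints C ℂ | Nonempty (fiberOver π t' ≅ X)}) →
        c ∈ algebraicClasses X 2 := by
  sorry

/-! ### Consistency: each named statement IS its registered stub (definitionally) -/

theorem fanoRangeTwoTwo_holds : FanoRangeTwoTwo := stub_fanoRange
theorem movableTwoTwo_holds : MovableTwoTwo := stub_movable
theorem rigidImpliesQbarFour_holds : RigidImpliesQbarFour := stub_rigidQbar
theorem rigidQbarTwoTwo_holds : RigidQbarTwoTwo := stub_rigidQbarAlgebraic

/-! ### Name-keyed aliases of the four statements (the hypotheses of the composition) -/
namespace Registered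

/-- Alias of `FanoRangeTwoTwo` keyed by the registered stub name. -/
abbrev stub_fanoRange : Prop := FanoRangeTwoTwo
/-- Alias of `MovableTwoTwo` keyed by the registered stub name. -/
abbrev stub_movable : Prop := MovableTwoTwo
/-- Alias of `RigidImpliesQbarFour` keyed by the registered stub name. -/
abbrev stub_rigidQbar : Prop := RigidImpliesQbarFour
/-- Alias of `RigidQbarTwoTwo` keyed by the registered stub name. -/
abbrev stub_rigidQbarAlgebraic : Prop := RigidQbarTwoTwo

end Registered

/-! ## The composition (PROVED, no sorry): Step 0 + regime split + movable / rigid case split -/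

/-- **The `(2,2)`-slice of the crux from the four stubs** (all degrees): `d ≤ 5` is STUB 1; for
`6 ≤ d` a rational `(2,2)`-class either moves — STUB 2 — or it does not, and then STUB 3 puts `X`
over `ℚ̄` and STUB 4 makes the class algebraic (`Classical.em`). -/
theorem twoTwo_of_stubs (h₁ : Registered.stub_fanoRange) (h₂ : Registered.stub_movable)
    (h₃ : Registered.stub_rigidQbar) (h₄ : Registered.stub_rigidQbarAlgebraic) ⦃d : ℕ⦄
    ⦃X : SchemeOver ℂ⦄ (hX : IsSmoothHypersurface 4 d X) (c : complexBetti X (2 * 2))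
    (hc : IsRationalClass c) (hpp : IsOfHodgeType 4 X (2 * 2) 2 2 c) : c ∈ algebraicClasses X 2 := by
  by_cases hd : d ≤ 5
  · exact h₁ hd hX c hc hpp
  · have hd' : 6 ≤ d := by omega
    exact (Classical.em _).elim (fun hmov => h₂ hd' hX c hc hpp hmov)
      (fun hrig => h₄ hd' hX (h₃ hd' hX c hc hpp hrig) c hc hpp hrig)

/-- **SKELETON THEOREM.** The crux `HypersurfaceHodgeFour` of route `LimitExtension`, BY NAME, from
the four registered stubs: Step 0 (`Theorems.limitExtension_hypersurfaceHodgeFour_of_twoTwo`, proved: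
Hodge model + all degrees `2p ≠ 4`) reduces each smooth hypersurface fourfold to its `(2,2)`-slice,
which is `twoTwo_of_stubs`. -/
theorem HypersurfaceHodgeFour_of (h₁ : Registered.stub_fanoRange) (h₂ : Registered.stub_movable)
    (h₃ : Registered.stub_rigidQbar) (h₄ : Registered.stub_rigidQbarAlgebraic) :
    Summit.HodgeConjecture.HodgeConjecture.Theses.LimitExtension.HypersurfaceHodgeFour := by
  intro d X hX
  exact Theorems.limitExtension_hypersurfaceHodgeFour_of_twoTwo hX (twoTwo_of_stubs h₁ h₂ h₃ h₄ hX)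

/-! ## Sanity checks (PROVED): where each stub sits relative to existing items -/

/- STUB 1 is implied by (indeed equivalent to) the route's support item
`HypersurfaceHodgeFourLowDegree` (stmt-HodgeConjecture-3003). -/
example (h : HypersurfaceHodgeFourLowDegree) : FanoRangeTwoTwo :=
  fun _ _ hd hX => Theorems.limitExtension_twoTwo_of_hypersurfaceHodgeFourLowDegree h hd hX

/- … and conversely STUB 1 gives that item back (Step 0). -/
example (h : FanoRangeTwoTwo) : HypersurfaceHodgeFourLowDegree :=
  Theorems.limitExtension_hypersurfaceHodgeFourLowDegree_of_twoTwo h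

/- STUB 1 is CLOSED MODULO the single named fact Bloch–Srinivas Prop. 10.26 (landed:
`Theorems.limitExtension_hypersurfaceHodgeFourLowDegree_of_blochSrinivas_only`). -/
example (hBS : Literature.Barriers.HodgeConjecture.BlochSrinivas1983_hodgeConjectureDegreeFour_of_chowZeroSupported) :
    FanoRangeTwoTwo :=
  fun _ _ hd hX => Theorems.limitExtension_twoTwo_of_hypersurfaceHodgeFourLowDegree
    (Theorems.limitExtension_hypersurfaceHodgeFourLowDegree_of_blochSrinivas_only hBS) hd hX

/- STUB 2 is the `(4,2)`, `d ≥ 6` instance of FiniteTreeOfFlavours' crux `MovableClassesAlgebraic`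
(stmt-HodgeConjecture-1493). -/
example (h : Theses.FiniteTreeOfFlavours.MovableClassesAlgebraic) : MovableTwoTwo :=
  fun _ _ _ hX c hc hpp hmov => h hX 2 c hc hpp hmov

/- STUB 3 is the `(4,2)`, `d ≥ 6` instance of FiniteTreeOfFlavours' crux `RigidImpliesQbar`
(stmt-HodgeConjecture-1494). -/
example (h : Theses.FiniteTreeOfFlavours.RigidImpliesQbar) : RigidImpliesQbarFour :=
  fun _ _ _ hX c hc hpp hrig => h hX 2 c hc hpp hrig

/- STUB 4 is the `(4,2)`, `d ≥ 6` instance of FiniteTreeOfFlavours' crux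
`RigidQbarClassesAlgebraic` (stmt-HodgeConjecture-1495). -/
example (h : Theses.FiniteTreeOfFlavours.RigidQbarClassesAlgebraic) : RigidQbarTwoTwo :=
  fun _ _ _ hX hF c hc hpp hrig => h hX hF 2 c hc hpp hrig

/- NECESSITY: stubs 1, 2 and 4 are formally implied by the crux itself (so none of them can be
refuted short of refuting the crux); STUB 3 is the one piece that is not. -/
example (h : HypersurfaceHodgeFour) : FanoRangeTwoTwo ∧ MovableTwoTwo ∧ RigidQbarTwoTwo :=
  ⟨fun _ _ _ hX c hc hpp => (h hX).2 2 c hc hpp,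
    fun _ _ _ hX c hc hpp _ => (h hX).2 2 c hc hpp,
    fun _ _ _ hX _ c hc hpp _ => (h hX).2 2 c hc hpp⟩

/-! ## Special case (PROVED in the tree; BC5): the crux holds outright in degrees `d ≤ 2` -/

/- BC5 — a genuine special case of the CRUX with no sorry and no hypothesis: `d = 0` (vacuous: no
irreducible form of degree 0), the hyperplane `X ≅ ℙ⁴` (`d = 1`) and the smooth quadric fourfold
(`d = 2`: `H⁴ = ℂ²` spanned by the two rulings), landed as
`Theorems.limitExtension_hypersurfaceHodgeFourLowDegree_of_le_two` — the definitions compute and the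
crux is inhabited in kind. -/
example ⦃d : ℕ⦄ ⦃X : SchemeOver ℂ⦄ (hd : d ≤ 2) (hX : IsSmoothHypersurface 4 d X) :
    HodgeConjectureFor 4 X :=
  Theorems.limitExtension_hypersurfaceHodgeFourLowDegree_of_le_two hd hX

end Summit.HodgeConjecture.HodgeConjecture.Cruxes.HypersurfaceHodgeFour.Birth

end
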